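import Mathlib

/-!
# A periodic piecewise-monotone time change through prescribed knots

Support file for `RectilinearSuffices` / `Assembly` (route CardyBoundaryCoulombGas of
`CardyFormulaZ2`, items stmt-CriticalPhenomena-5663 / 13894), fourth file of the grid-polygon
approximation of a Jordan curve.

Given knots `τ 0 < τ 1 < ⋯ < τ n = τ 0 + 1` (`n ≥ 1`) we produce a homeomorphism `θ : ℝ → ℝ`,
strictly increasing, with `θ (u + 1) = θ u + 1` and `θ (τ j) = j / n` (`exists_time_change`):
the inverse of the `1`-equivariant extension of the monotone ramp interpolation
`s ↦ τ 0 + ∑_{j<n} (τ (j+1) - τ j) · clamp (s - j)` on `[0, n]`. Composing the closed polygon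
`polygonLoop` (uniform knots `j / n`) with `θ` re-times it through the knots `τ j`, which is how
the lattice polygon of the erased walk is compared with the loop in the loop's own parameter.
-/

noncomputable section

namespace Summit.CriticalPhenomena.CardyFormulaZ2.Theorems

namespace RectilinearApproximation

open Set Filter Topology

/-- **Monotone ramp interpolation.** For values `τ 0 ≤ τ 1 ≤ ⋯` (strictly increasing below `n`)
there is a continuous, monotone function `σ₀ : ℝ → ℝ`, strictly monotone on `[0, n]`, with
`σ₀ j = τ j` for `j ≤ n`. [folklore] -/
theorem exists_ramp_interpolation (n : ℕ) (τ : ℕ → ℝ) (hτ : ∀ j < n, τ j < τ (j + 1)) :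
    ∃ σ₀ : ℝ → ℝ, Continuous σ₀ ∧ Monotone σ₀ ∧ StrictMonoOn σ₀ (Icc 0 n) ∧
      ∀ j ≤ n, σ₀ j = τ j := by
  -- the clamp `x ↦ max 0 (min 1 x)` and the interpolation
  set cl : ℝ → ℝ := fun x => max 0 (min 1 x) with hcl
  have cl_mono : Monotone cl := fun x y hxy => max_le_max le_rfl (min_le_min le_rfl hxy)
  have cl_cont : Continuous cl := by simp only [hcl]; fun_prop
  have cl_of_le : ∀ {x : ℝ}, x ≤ 0 → cl x = 0 := fun {x} hx => by
    simp only [hcl]; exact max_eq_left ((min_le_right _ _).trans hx)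
  have cl_of_ge : ∀ {x : ℝ}, 1 ≤ x → cl x = 1 := fun {x} hx => by
    simp only [hcl]; rw [min_eq_left hx, max_eq_right zero_le_one]
  have cl_of_mem : ∀ {x : ℝ}, 0 ≤ x → x ≤ 1 → cl x = x := fun {x} h0 h1 => by
    simp only [hcl]; rw [min_eq_right h1, max_eq_right h0]
  set σ₀ : ℝ → ℝ := fun s => τ 0 + ∑ j ∈ Finset.range n, (τ (j + 1) - τ j) * cl (s - j) with hσ₀
  have hpos : ∀ j ∈ Finset.range n, 0 < τ (j + 1) - τ j := fun j hj =>
    sub_pos.2 (hτ j (Finset.mem_range.1 hj))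
  refine ⟨σ₀, ?_, ?_, ?_, ?_⟩
  · simp only [hσ₀]; fun_prop
  · intro s s' hss'
    simp only [hσ₀]
    gcongr with j hj
    · exact (hpos j hj).le
    · exact cl_mono (by linarith)
  · intro s hs s' hs' hss'
    simp only [hσ₀, add_lt_add_iff_left]
    -- the ramp `j₀ = ⌊s⌋` (or `n - 1` when `s` is close to `n`) increases strictly
    obtain ⟨j₀, hj₀n, hj₀s, hsj₀⟩ : ∃ j₀ : ℕ, j₀ < n ∧ (j₀ : ℝ) ≤ s ∧ s < j₀ + 1 := by
      have hn : 0 < n := by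
        rcases Nat.eq_zero_or_pos n with rfl | h
        · simp only [Nat.cast_zero, mem_Icc] at hs hs'; linarith
        · exact h
      by_cases hsn : s < n
      · refine ⟨⌊s⌋₊, ?_, Nat.floor_le hs.1, Nat.lt_floor_add_one s⟩
        exact (Nat.floor_lt hs.1).2 hsn
      · refine ⟨n - 1, by omega, ?_, ?_⟩
        · rw [Nat.cast_sub hn, Nat.cast_one]; linarith [hs.2]
        · rw [Nat.cast_sub hn, Nat.cast_one]; linarith [hs'.2]
    apply Finset.sum_lt_sum
    · intro j hj
      exact mul_le_mul_of_nonneg_left (cl_mono (by linarith)) (hpos j hj).le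
    · refine ⟨j₀, Finset.mem_range.2 hj₀n, mul_lt_mul_of_pos_left ?_ (hpos j₀ (Finset.mem_range.2 hj₀n))⟩
      rw [cl_of_mem (by linarith) (by linarith)]
      simp only [hcl]
      refine lt_max_of_lt_right (lt_min (by linarith) (by linarith))
  · -- values at the integer knots, by induction
    have h0 : σ₀ 0 = τ 0 := by
      simp only [hσ₀, add_eq_left]
      refine Finset.sum_eq_zero fun j _ => ?_
      rw [cl_of_le (by simp), mul_zero]
    have hstep : ∀ j' : ℕ, j' < n → σ₀ (j' + 1 : ℕ) = σ₀ j' + (τ (j' + 1) - τ j') := by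
      intro j' hj'
      simp only [hσ₀, add_assoc, add_right_inj]
      -- identify the increment with the single term `j = j'`
      · have key : ∑ j ∈ Finset.range n, (τ (j + 1) - τ j) * (cl (((j' + 1 : ℕ) : ℝ) - j) - cl ((j' : ℝ) - j)) =
            τ (j' + 1) - τ j' := by
          rw [Finset.sum_eq_single j']
          · push_cast
            rw [show (j' : ℝ) + 1 - j' = 1 by ring, sub_self, cl_of_ge le_rfl, cl_of_le le_rfl]; ring
          · intro j hj hjj'
            rcases lt_or_gt_of_ne hjj' with hlt | hgt
            · have : (j : ℝ) + 1 ≤ j' := by exact_mod_cast hlt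
              rw [cl_of_ge (by push_cast; linarith), cl_of_ge (by linarith)]; ring
            · have : (j' : ℝ) + 1 ≤ j := by exact_mod_cast hgt
              rw [cl_of_le (by push_cast; linarith), cl_of_le (by linarith)]; ring
          · intro h; exact absurd (Finset.mem_range.2 hj') h
        have e : ∀ j : ℕ, (τ (j + 1) - τ j) * cl (((j' + 1 : ℕ) : ℝ) - j) =
            (τ (j + 1) - τ j) * cl ((j' : ℝ) - j) + (τ (j + 1) - τ j) * (cl (((j' + 1 : ℕ) : ℝ) - j) - cl ((j' : ℝ) - j)) :=
          fun j => by ring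
        rw [Finset.sum_congr rfl fun j _ => e j, Finset.sum_add_distrib, key]
    intro j hj
    induction j with
    | zero => exact_mod_cast h0
    | succ j ih =>
      rw [hstep j (by omega), ih (by omega)]
      ring

/-- **Periodic time change through prescribed knots.** For knots `τ 0 < ⋯ < τ n = τ 0 + 1`,
`n ≥ 1`, there is a strictly increasing continuous surjection `θ : ℝ → ℝ` with
`θ (u + 1) = θ u + 1` and `θ (τ j) = j / n` for `j ≤ n` (the inverse of the `1`-equivariant
extension of the ramp interpolation of the knots). [folklore] -/
theorem exists_time_change {n : ℕ} (hn : 1 ≤ n) (τ : ℕ → ℝ) (hτ : ∀ j < n, τ j < τ (j + 1))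
    (hτn : τ n = τ 0 + 1) :
    ∃ θ : ℝ → ℝ, Continuous θ ∧ StrictMono θ ∧ Function.Surjective θ ∧
      (∀ u, θ (u + 1) = θ u + 1) ∧ ∀ j ≤ n, θ (τ j) = j / n := by
  obtain ⟨σ₀, hc, hmono, hsmono, hval⟩ := exists_ramp_interpolation n τ hτ
  have hn' : (0 : ℝ) < n := by exact_mod_cast hn
  have hσ₀0 : σ₀ 0 = τ 0 := by exact_mod_cast hval 0 (Nat.zero_le _)
  have hσ₀n : σ₀ n = τ 0 + 1 := by rw [hval n le_rfl, hτn]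
  -- the equivariant extension `σ s = ⌊s⌋ + σ₀ (n · fract s) = s + B (fract s)`
  set B : ℝ → ℝ := fun y => σ₀ (n * y) - y with hB
  have hBc : Continuous B := by simp only [hB]; fun_prop
  have hB01 : B 0 = B 1 := by simp only [hB, mul_zero, mul_one, hσ₀0, hσ₀n]; ring
  set σ : ℝ → ℝ := fun s => s + B (Int.fract s) with hσ
  have hσ_eq : ∀ s, σ s = ⌊s⌋ + σ₀ (n * Int.fract s) := fun s => by
    simp only [hσ, hB]; rw [Int.fract]; ring
  have hσc : Continuous σ := continuous_id.add (hBc.continuousOn.comp_fract'' hB01)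
  have hσ1 : ∀ s, σ (s + 1) = σ s + 1 := fun s => by
    rw [hσ_eq, hσ_eq, Int.fract_add_one, Int.floor_add_one]; push_cast; ring
  -- strict monotonicity
  have hfr : ∀ s, (n : ℝ) * Int.fract s ∈ Icc (0 : ℝ) n := fun s =>
    ⟨mul_nonneg hn'.le (Int.fract_nonneg s), by nlinarith [Int.fract_lt_one s]⟩
  have hσm : StrictMono σ := by
    intro s s' hss'
    rw [hσ_eq, hσ_eq]
    rcases lt_or_eq_of_le (Int.floor_mono hss'.le) with hlt | heq
    · have h1 : σ₀ (n * Int.fract s) < σ₀ n :=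
        hsmono (hfr s) ⟨hn'.le, le_rfl⟩ (by nlinarith [Int.fract_lt_one s])
      have h2 : σ₀ 0 ≤ σ₀ (n * Int.fract s') := hmono (hfr s').1
      have h3 : ((⌊s⌋ : ℤ) : ℝ) + 1 ≤ ⌊s'⌋ := by exact_mod_cast hlt
      rw [hσ₀n] at h1; rw [hσ₀0] at h2
      linarith
    · rw [heq, add_lt_add_iff_left]
      refine hsmono (hfr s) (hfr s') (mul_lt_mul_of_pos_left ?_ hn')
      have e1 : Int.fract s = s - ⌊s⌋ := rfl
      have e2 : Int.fract s' = s' - ⌊s'⌋ := rfl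
      rw [e1, e2, heq]; linarith
  -- surjectivity
  obtain ⟨M, hM⟩ : ∃ M, ∀ y ∈ Icc (0 : ℝ) 1, |B y| ≤ M := by
    obtain ⟨M, hM⟩ := isCompact_Icc.exists_bound_of_continuousOn (hBc.continuousOn (s := Icc (0 : ℝ) 1))
    exact ⟨M, fun y hy => by simpa [Real.norm_eq_abs] using hM y hy⟩
  have hσb : ∀ s, s - M ≤ σ s ∧ σ s ≤ s + M := fun s => by
    have := abs_le.1 (hM (Int.fract s) ⟨Int.fract_nonneg s, (Int.fract_lt_one s).le⟩)
    simp only [hσ]; constructor <;> linarith [this.1, this.2]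
  have hσs : Function.Surjective σ :=
    hσc.surjective
      (tendsto_atTop_mono (fun s => (hσb s).1) (tendsto_atTop_add_const_right _ _ tendsto_id))
      (tendsto_atBot_mono (fun s => (hσb s).2) (tendsto_atBot_add_const_right _ _ tendsto_id))
  -- the inverse
  set e : ℝ ≃o ℝ := StrictMono.orderIsoOfSurjective σ hσm hσs with he
  have he_apply : ∀ s, e s = σ s := fun s => rfl
  refine ⟨e.symm, e.symm.continuous, e.symm.strictMono, e.symm.surjective, ?_, ?_⟩
  · intro u
    obtain ⟨s, rfl⟩ := hσs u
    rw [← hσ1, ← he_apply, ← he_apply, e.symm_apply_apply, e.symm_apply_apply]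
  · intro j hj
    rcases lt_or_eq_of_le hj with hlt | heq
    · have hsj : σ (j / n) = τ j := by
        have hfrac : Int.fract ((j : ℝ) / n) = j / n :=
          Int.fract_eq_self.2 ⟨by positivity, (div_lt_one hn').2 (by exact_mod_cast hlt)⟩
        have hfl : ⌊(j : ℝ) / n⌋ = 0 :=
          Int.floor_eq_zero_iff.2 ⟨by positivity, (div_lt_one hn').2 (by exact_mod_cast hlt)⟩
        rw [hσ_eq, hfrac, hfl, mul_div_cancel₀ _ hn'.ne', hval j hj]; simp
      rw [← hsj, ← he_apply, e.symm_apply_apply]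
    · rw [heq]
      have hs1 : σ 1 = τ n := by
        rw [hσ_eq, Int.fract_one, Int.floor_one, mul_zero, hσ₀0, hτn]; push_cast; ring
      rw [← hs1, ← he_apply, e.symm_apply_apply, div_self hn'.ne']

end RectilinearApproximation

end Summit.CriticalPhenomena.CardyFormulaZ2.Theorems
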